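import Summits.NavierStokesRegularity.NavierStokesRegularity.Theorems.FrozenSignCascadeBoundedEnvelopeContinuationOfLiouville
import Summits.NavierStokesRegularity.NavierStokesRegularity.Theorems.FrozenSignCascadeBoundedEnvelopeContinuationLiouvilleMorreySmall
import HarnessLib

/-!
# Route FrozenSignCascade · crux `BoundedEnvelopeContinuation` — the small-Morrey regime, part 3:
# the crux under a SMALL critical envelope (unconditional)

Helper file for the crux item stmt-NavierStokesRegularity-10579 (`BoundedEnvelopeContinuation`,
conjunct (B) of route `FrozenSignCascade`), line `registered` (reshape r3); lands `--supports`
that item. Sequel of `…SmallMorrey.lean` and `…LiouvilleMorreySmall.lean`.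

**Theorem (`boundedEnvelopeContinuation_smallEnvelope`, registered sub-goal).** There is a
universal `c₀ > 0` such that for every viscosity `ν > 0` and every Clay datum `u₀`: if along every
Fourier-side mild solution `V` from `𝓕⁻¹u₀` on `[0, T]` (any `T`) the critical Fourier envelope
obeys `‖ξ‖² ‖V(t,ξ)‖ ≤ c₀ ν`, then `u₀` launches a global smooth bounded-energy (Clay) solution.
This is the crux (B) `BoundedEnvelopeContinuation` with its ARBITRARY envelope constants `C(T₀)`
replaced by the universal small constant `c₀ ν` — the honest reach of the line's machinery
without the open Liouville stub (L_M): the regime of a uniformly small `PM²` norm up to the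
putative blow-up time (Le Jan–Sznitman / Cannone–Karch smallness, here obtained on the physical
side through the Koch–Nadirashvili–Seregin–Šverák record zoom and ε-regularity, with no Picard
iteration in `PM²`).

**Proof.** The composition `boundedEnvelopeContinuation_of_liouvilleMorrey` of the landed stubs
(lead c2), run with the envelope constant `C = c₀ν`: every slice is in the Morrey class with
constant `κ C²` (`stub_morreyOfEnvelope`), a failure of backward boundedness zooms
(`stub_recordSequence`, `zoomLimitMorrey_explicit` = `stub_zoomLimitMorrey` with its Morrey
constant `κC²/ν² = κ c₀²` made explicit, `stub_nearFinalPersistence`) to a NONZERO bounded ancient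
mild solution with Morrey constant `κ c₀² ≤ M₀` — impossible by the small-Morrey Liouville theorem
`liouvilleMorrey_small` (part 2) once `c₀ = √(M₀/(κ+1))`; so every classical Leray–Hopf solution
from the datum is backward bounded and `stub_clayOfBackwardBounded` concludes.

## References

* G. Koch, N. Nadirashvili, G. Seregin, V. Šverák, Acta Math. 203 (2009) = arXiv:0709.3599,
  Lemma 6.1, Prop. 4.1. [KochNadirashviliSereginSverak2009]
* L. Caffarelli, R. Kohn, L. Nirenberg, Comm. Pure Appl. Math. 35 (1982). [CaffarelliKohnNirenberg1982]
* Y. Le Jan, A.-S. Sznitman, Probab. Theory Related Fields 109 (1997); M. Cannone, G. Karch,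
  J. Differential Equations 197 (2004) (smallness in `PM²`). [LeJanSznitman1997, CannoneKarch2004]
* P. G. Lemarié-Rieusset, *The Navier–Stokes problem in the 21st century* (2016), Thm 14.4,
  Thm 15.1. [LemarieRieusset2016]
-/

noncomputable section

set_option linter.dupNamespace false -- nested layout Summit.<S>.<Sub>, Sub = S (D-0017)

open Set MeasureTheory Filter Topology Metric Function TopologicalSpace
open scoped ENNReal NNReal InnerProductSpace RealInnerProductSpace
open Literature.Analysis Literature.Analysis.FluidPDE Literature.Analysis.FluidPDE.FourierNS

namespace Summit.NavierStokesRegularity.NavierStokesRegularity.Theorems.BoundedEnvelope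

/-! ### The record zoom limit with its Morrey constant made explicit -/

/-- **The KNSS record zoom limit with the EXPLICIT inherited Morrey constant `M/ν²`** — the landed
stub `stub_zoomLimitMorrey` (KNSS 2009, Lemma 6.1; file `…ZoomLimitMorrey.lean`, lead c2) states
`∃ M'`; its proof produces `M' = M/ν²`, which the small-envelope corollary needs. Same proof.
[cite: KochNadirashviliSereginSverak2009, Lemma 6.1 and Prop. 4.1 (arXiv:0709.3599)] -/
theorem zoomLimitMorrey_explicit :
    ∀ (ν T : ℝ), 0 < ν → 0 < T →
      ∀ (u : ℝ → EuclideanSpace ℝ (Fin 3) → EuclideanSpace ℝ (Fin 3))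
        (p : ℝ → EuclideanSpace ℝ (Fin 3) → ℝ),
        IsClassicalNSSolutionOn (Set.Ico 0 T) ν 0 u p → IsLerayHopfOn T ν 0 (u 0) u →
        ∀ M : ℝ, (∀ t ∈ Set.Ioo 0 T, ∀ (x₁ : EuclideanSpace ℝ (Fin 3)) (r : ℝ), 0 < r → 17 * r ≤ 1 →
            ∫ x in Metric.ball x₁ r, ‖u t x‖ ^ 2 ≤ M * r) →
        ∀ (tc : ℕ → ℝ) (xc : ℕ → EuclideanSpace ℝ (Fin 3)) (Λ e : ℕ → ℝ),
          (∀ n, 0 < tc n) → (∀ n, 0 < e n) → (∀ n, tc n + e n < T) → (∀ n, 0 < Λ n) →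
          (∀ n, ∀ s ∈ Set.Icc 0 (tc n + e n), ∀ x, ‖u s x‖ ≤ 2 * Λ n) →
          Tendsto Λ atTop atTop → Tendsto (fun n => tc n * Λ n ^ 2) atTop atTop →
          ∀ z : ℕ → ℝ → EuclideanSpace ℝ (Fin 3) → EuclideanSpace ℝ (Fin 3),
            (∀ n s y, z n s y = (Λ n)⁻¹ • u (tc n + ν / Λ n ^ 2 * s) (xc n + (ν / Λ n) • y)) →
            ∃ (φ : ℕ → ℕ) (v : ℝ → EuclideanSpace ℝ (Fin 3) → EuclideanSpace ℝ (Fin 3)),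
              StrictMono φ ∧
              (∀ s < 0, ∀ y, Tendsto (fun n => z (φ n) s y) atTop (𝓝 (v s y))) ∧
              IsBoundedAncientMildSolution 1 v ∧
              ContDiffOn ℝ (⊤ : ℕ∞) (uncurry v) (Set.Iio 0 ×ˢ Set.univ) ∧
              (∀ s t : ℝ, s < t → t < 0 → ∀ x,
                v t x = UnboundedOperators.heatExtension (v s) (t - s) x - oseenDuhamel 1 s v v t x) ∧
              (∀ t < 0, ∀ (y : EuclideanSpace ℝ (Fin 3)) (r : ℝ), 0 < r →
                ∫ x in Metric.ball y r, ‖v t x‖ ^ 2 ≤ M / ν ^ 2 * r) := by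
  intro ν T hν hT u p hcl hLH M hMor tc xc Λ e htc he hte hΛ hdom hΛlim hprod z hz
  -- ### scales `α = Λ⁻¹`, `γ = ν/Λ`, `β = α γ = ν/Λ²` (viscosity `α ν/γ = 1`), windows
  have hαpos : ∀ n, 0 < (Λ n)⁻¹ := fun n => inv_pos.2 (hΛ n)
  have hγpos : ∀ n, 0 < ν / Λ n := fun n => div_pos hν (hΛ n)
  have hβpos : ∀ n, 0 < ν / Λ n ^ 2 := fun n => div_pos hν (pow_pos (hΛ n) 2)
  obtain ⟨A, hA⟩ : ∃ A : ℕ → ℝ, ∀ n, A n = -(tc n * Λ n ^ 2 / ν) := ⟨_, fun n => rfl⟩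
  obtain ⟨b, hb⟩ : ∃ b : ℕ → ℝ, ∀ n, b n = e n * Λ n ^ 2 / ν := ⟨_, fun n => rfl⟩
  have halg : ∀ n s, ν / Λ n ^ 2 = (Λ n)⁻¹ * (ν / Λ n) ∧ (Λ n)⁻¹ * ν / (ν / Λ n) = 1 ∧
      tc n + ν / Λ n ^ 2 * s = ν / Λ n ^ 2 * (s - A n) ∧
      tc n + e n - (tc n + ν / Λ n ^ 2 * s) = ν / Λ n ^ 2 * (b n - s) ∧
      (Λ n)⁻¹ * (2 * Λ n) = 2 := by
    intro n s
    have hΛn : Λ n ≠ 0 := (hΛ n).ne'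
    have hν0 : ν ≠ 0 := hν.ne'
    rw [hA n, hb n]
    refine ⟨?_, ?_, ?_, ?_, ?_⟩ <;> field_simp <;> ring
  have hbpos : ∀ n, 0 < b n := fun n =>
    (hb n).symm ▸ div_pos (mul_pos (he n) (pow_pos (hΛ n) 2)) hν
  have hAneg : ∀ n, A n < 0 := fun n => by
    rw [hA n]; exact neg_neg_of_pos (div_pos (mul_pos (htc n) (pow_pos (hΛ n) 2)) hν)
  -- original times of rescaled times
  have hmem_Icc : ∀ n s, A n < s → s ≤ b n →
      tc n + ν / Λ n ^ 2 * s ∈ Icc 0 (tc n + e n) := by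
    intro n s h1 h2
    obtain ⟨-, -, hoA, hob, -⟩ := halg n s
    have h3 : 0 ≤ ν / Λ n ^ 2 * (s - A n) := mul_nonneg (hβpos n).le (by linarith)
    have h4 : 0 ≤ ν / Λ n ^ 2 * (b n - s) := mul_nonneg (hβpos n).le (by linarith)
    constructor <;> linarith
  have hmem_Ico : ∀ n s, A n < s → s < b n → tc n + ν / Λ n ^ 2 * s ∈ Ico 0 T := by
    intro n s h1 h2
    have h := hmem_Icc n s h1 h2.le
    exact ⟨h.1, h.2.trans_lt (hte n)⟩
  have hmem_Ioo : ∀ n s, A n < s → s < 0 → tc n + ν / Λ n ^ 2 * s ∈ Ioo 0 (tc n) := by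
    intro n s h1 h2
    obtain ⟨-, -, hoA, -, -⟩ := halg n s
    have h3 : 0 < ν / Λ n ^ 2 * (s - A n) := mul_pos (hβpos n) (by linarith)
    have h4 : ν / Λ n ^ 2 * s < 0 := mul_neg_of_pos_of_neg (hβpos n) h2
    constructor <;> linarith
  -- ### the zooms are classical solutions with viscosity `1` on `(A n, b n)`
  have hzslice : ∀ n s, z n s =
      (Λ n)⁻¹ • fun y => u (tc n + ν / Λ n ^ 2 * s) (xc n + (ν / Λ n) • y) :=
    fun n s => funext fun y => hz n s y
  have hzeq : ∀ n, z n = (Λ n)⁻¹ • stPull (ν / Λ n ^ 2) (ν / Λ n) (tc n) (xc n) u :=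
    fun n => funext fun s => funext fun y => by rw [hz n s y]; rfl
  have hclz : ∀ n, IsClassicalNSSolutionOn (Ioo (A n) (b n)) 1 0 (z n)
      ((Λ n)⁻¹ ^ 2 • stPull (ν / Λ n ^ 2) (ν / Λ n) (tc n) (xc n) p) := by
    intro n
    obtain ⟨hβeq, hvisc, -⟩ := halg n 0
    have h := hcl.stRescale (hαpos n) (hγpos n) hβeq (tc n) (xc n)
    rw [smul_stPull_zero, hvisc, ← hzeq n] at h
    exact h.mono (fun s hs => hmem_Ico n s hs.1 hs.2) (uniqueDiffOn_Ioo _ _)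
  have hC1z : ∀ n s, s ∈ Ioo (A n) (b n) → ContDiff ℝ 1 (z n s) := fun n s hs =>
    ((hclz n).contDiff_velocity hs).of_le (by norm_cast)
  -- ### the inputs of KNSS 2009, Lemma 6.1
  have hAlim : Tendsto A atTop atBot := by
    refine (tendsto_neg_atTop_atBot.comp (hprod.atTop_div_const hν)).congr fun n => ?_
    rw [hA n, Function.comp_apply]
  have hcontz : ∀ n, ContinuousOn (uncurry (z n)) (Ioo (A n) 0 ×ˢ univ) := fun n =>
    (hclz n).smooth_velocity.continuousOn.mono
      (prod_mono (Ioo_subset_Ioo_right (hbpos n).le) subset_rfl)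
  have hs_lt_b : ∀ n s, s ≤ 0 → s < b n := fun n s hs => lt_of_le_of_lt hs (hbpos n)
  have hdivz : ∀ n, ∀ s ∈ Ioo (A n) 0, IsWeaklyDivFree (z n s) := fun n s hs =>
    VectorCalculus.IsDivFree.isWeaklyDivFree_holds
      ((hclz n).divFree s ⟨hs.1, hs_lt_b n s hs.2.le⟩) (hC1z n s ⟨hs.1, hs_lt_b n s hs.2.le⟩)
  have hzb : ∀ n s, A n < s → s ≤ b n → ∀ y, ‖z n s y‖ ≤ 2 := by
    intro n s h1 h2 y
    obtain ⟨-, -, -, -, h2Λ⟩ := halg n s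
    rw [hz n s y, norm_smul, Real.norm_of_nonneg (hαpos n).le, ← h2Λ]
    exact mul_le_mul_of_nonneg_left (hdom n _ (hmem_Icc n s h1 h2) _) (hαpos n).le
  have hzb0 : ∀ n s, A n < s → s ≤ 0 → ∀ y, ‖z n s y‖ ≤ 2 := fun n s h1 h2 y =>
    hzb n s h1 (h2.trans (hbpos n).le) y
  -- `L²` bounds of the zoom slices (Leray–Hopf energy bound and change of variables)
  obtain ⟨E2, hE2top, hE2⟩ : ∃ E2 : ℝ≥0∞, E2 ≠ ∞ ∧ ∀ t ∈ Icc 0 T, eLpNorm (u t) 2 volume ≤ E2 := by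
    refine ⟨ENNReal.ofReal (Real.sqrt (2 * VectorCalculus.kineticEnergy (u 0))),
      ENNReal.ofReal_ne_top, fun t ht => (ENNReal.pow_le_pow_left_iff two_ne_zero).1 ?_⟩
    rw [eLpNorm_two_sq_eq_lintegral, ← ENNReal.ofReal_pow (Real.sqrt_nonneg _),
      Real.sq_sqrt (mul_nonneg zero_le_two (kineticEnergy_nonneg _))]
    exact hLH.lintegral_enorm_sq_le hν.le ht
  have hKz : ∀ n, ∃ K : ℝ≥0∞, K ≠ ∞ ∧ ∀ s, A n < s → s ≤ b n → eLpNorm (z n s) 2 volume ≤ K := by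
    intro n
    refine ⟨‖(Λ n)⁻¹‖ₑ *
      (ENNReal.ofReal ((ν / Λ n) ^ Module.finrank ℝ (EuclideanSpace ℝ (Fin 3)))⁻¹ ^
        (1 / (2 : ℝ≥0∞)).toReal * E2), ?_, fun s h1 h2 => ?_⟩
    · exact ENNReal.mul_ne_top enorm_ne_top (ENNReal.mul_ne_top
        (ENNReal.rpow_ne_top_of_nonneg ENNReal.toReal_nonneg ENNReal.ofReal_ne_top) hE2top)
    · rw [hzslice n s, eLpNorm_const_smul,
        RecordZoomAncient.Birth.eLpNorm_comp_space_affine (hγpos n) (xc n) _ 2]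
      gcongr
      have h := hmem_Icc n s h1 h2
      exact hE2 _ ⟨h.1, h.2.trans (hte n).le⟩
  -- the Oseen identity of each zoom between negative times
  have hmildz : ∀ n, ∀ s t : ℝ, A n < s → s < t → t < 0 → ∀ x,
      z n t x = UnboundedOperators.heatExtension (z n s) (t - s) x -
        oseenDuhamel 1 s (z n) (z n) t x := by
    intro n s t h1 h2 h3 x
    obtain ⟨K, hKtop, hK⟩ := hKz n
    exact mild_of_bounded_of_eLpNorm_two_le_of_lt (hclz n) (h1.trans (h2.trans h3)) (hbpos n)
      (fun τ hτ y => hzb0 n τ hτ.1 hτ.2 y) hKtop (fun τ hτ => hK τ hτ.1 (hτ.2.trans (hbpos n).le))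
      h1 h2 h3 x
  -- ### KNSS 2009, Lemma 6.1: the subsequence and the ancient Oseen-mild limit
  obtain ⟨φ, W, hφ, hWc, hWdiv, hWb, hWmild, -, hpt, -⟩ :=
    KNSS2009_lemma61_oseenMild hAlim hcontz hdivz hmildz fun n τ hτ y => hzb0 n τ hτ.1 hτ.2.le y
  -- bounded ancient mild solution (duality form) and smoothness (KNSS 2009, Prop. 4.1)
  have hmildW : IsBoundedAncientMildSolution 1 W :=
    isBoundedAncientMildSolution_of_oseen one_pos hWc ⟨2, hWb⟩ hWdiv
      (fun s t hst ht x => by rw [one_mul]; exact hWmild s t hst ht x)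
  have hsm : IsSmoothSpaceTimeOn (Iio 0) W :=
    HardyAncientLimit.isSmoothSpaceTimeOn_of_oseen hWc zero_le_two hWb hWmild
  -- eventual facts along the subsequence
  have hevA : ∀ s : ℝ, ∀ᶠ j in atTop, A (φ j) < s := fun s =>
    (hAlim.comp hφ.tendsto_atTop).eventually (eventually_lt_atBot s)
  have hevΛ : ∀ R : ℝ, ∀ᶠ j in atTop, R ≤ Λ (φ j) := fun R =>
    (hΛlim.comp hφ.tendsto_atTop).eventually (eventually_ge_atTop R)
  refine ⟨φ, W, hφ, hpt, hmildW, hsm, hWmild, fun t ht y r hr => ?_⟩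
  -- ### the Morrey bound of the limit slices
  -- the Morrey bound of the zoom slices at radius `r`, eventually
  have hMorz : ∀ᶠ j in atTop, ∫ x in ball y r, ‖z (φ j) t x‖ ^ 2 ≤ M / ν ^ 2 * r := by
    filter_upwards [hevA t, hevΛ (17 * ν * r)] with j hjA hjΛ
    set n := φ j with hn
    -- the zoom in the form of `zoom_scaledEnergy_le` (factor `c = 1`)
    have hform : z n t = ((1 * (Λ n)⁻¹) • stPull (1 ^ 2 * (ν / Λ n ^ 2)) (1 * (ν / Λ n))
        (tc n) (xc n) u) t := by
      funext x
      rw [hz n t x, smul_stPull_apply, one_mul, one_pow, one_mul, one_mul]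
    have hMor' : ∀ t' ∈ Ioo 0 (tc n), ∀ (x₁ : EuclideanSpace ℝ (Fin 3)) (ρ : ℝ), 0 < ρ →
        ρ ≤ 1 / 17 → ∫ x in ball x₁ ρ, ‖u t' x‖ ^ 2 ≤ M * ρ := fun t' ht' x₁ ρ hρ hρ' =>
      hMor t' ⟨ht'.1, ht'.2.trans ((lt_add_of_pos_right _ (he n)).trans (hte n))⟩ x₁ ρ hρ
        (by linarith)
    have hs : tc n + 1 ^ 2 * (ν / Λ n ^ 2) * t ∈ Ioo 0 (tc n) := by
      rw [one_pow, one_mul]; exact hmem_Ioo n t hjA ht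
    have hrr : 1 * (ν / Λ n) * r ≤ 1 / 17 := by
      rw [one_mul, div_mul_eq_mul_div, div_le_div_iff₀ (hΛ n) (by norm_num : (0 : ℝ) < 17)]
      linarith
    have h := zoom_scaledEnergy_le (T := tc n) (x₀ := xc n) (u := u) (α := (Λ n)⁻¹)
      (β := ν / Λ n ^ 2) (hγpos n) one_pos hMor' hs y hr hrr
    rw [← hform] at h
    have hcst : (Λ n)⁻¹ ^ 2 * M / (ν / Λ n) ^ 2 = M / ν ^ 2 := by
      have hΛn : Λ n ≠ 0 := (hΛ n).ne'
      field_simp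
    rw [hcst] at h
    have h' := mul_le_mul_of_nonneg_left h hr.le
    rwa [← mul_assoc, mul_inv_cancel₀ hr.ne', one_mul, mul_comm r] at h'
  -- continuity and the bound `2` of the zoom slices at time `t`, eventually
  have hf : ∀ᶠ j in atTop, Continuous (z (φ j) t) ∧ ∀ x, ‖z (φ j) t x‖ ≤ 2 := by
    filter_upwards [hevA t] with j hjA
    exact ⟨(hC1z _ t ⟨hjA, hs_lt_b _ t ht.le⟩).continuous, fun x => hzb0 _ t hjA ht.le x⟩
  exact le_of_tendsto (tendsto_setIntegral_ball_norm_sq_of_eventually_bound hf (hpt t ht) y r)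
    hMorz


/-! ### The crux under a small critical envelope -/

/-- **Crux (B) `BoundedEnvelopeContinuation` under a SMALL critical envelope, unconditionally**
(statement and proof in the module docstring): there is a universal `c₀ > 0` such that a Clay
datum all of whose Fourier-side mild solutions keep `‖ξ‖² ‖V(t,ξ)‖ ≤ c₀ ν` launches a global
smooth bounded-energy solution.
[cite: KochNadirashviliSereginSverak2009, Lemma 6.1 and Prop. 4.1 (arXiv:0709.3599); LemarieRieusset2016, Thm. 15.1 (C)] -/
theorem boundedEnvelopeContinuation_smallEnvelope : ∃ c₀ : ℝ, 0 < c₀ ∧ ∀ ν : ℝ, 0 < ν → ∀ (u₀ :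
    EuclideanSpace ℝ (Fin 3) → EuclideanSpace ℝ (Fin 3)) (hu : ContDiff ℝ (⊤ : ℕ∞) u₀) (hd :
    Literature.Analysis.FluidPDE.HasRapidSpatialDecay u₀),
    Literature.Analysis.FluidPDE.NSWave0.IsDivFree u₀ → (∀ (T : ℝ) (V : ℝ → EuclideanSpace ℝ (Fin 3)
    → Fin 3 → ℂ), Literature.Analysis.FluidPDE.FourierNS.IsFourierMild (4 * Real.pi ^ 2 * ν) 4 0 T V
    → V 0 = Literature.Analysis.FluidPDE.FourierNS.fourierData hu hd → ∀ t ∈ Set.Icc 0 T, ∀ ξ :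
    EuclideanSpace ℝ (Fin 3), ‖ξ‖ ^ 2 * ‖V t ξ‖ ≤ c₀ * ν) → ∃ (u : ℝ → EuclideanSpace ℝ (Fin 3) →
    EuclideanSpace ℝ (Fin 3)) (p : ℝ → EuclideanSpace ℝ (Fin 3) → ℝ),
    Literature.Analysis.FluidPDE.IsSmoothOnHalfSpace u ∧
    Literature.Analysis.FluidPDE.IsSmoothOnHalfSpace p ∧
    Literature.Analysis.FluidPDE.IsNavierStokesSolution ν 0 u₀ u p ∧
    Literature.Analysis.FluidPDE.HasBoundedEnergy u := by
  -- ### the universal constants: Morrey embedding `κ`, Liouville threshold `M₀`, `c₀`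
  obtain ⟨κ, hκ0, hMor⟩ := stub_morreyOfEnvelope
  obtain ⟨M₀, hM₀, hLiou⟩ := liouvilleMorrey_small
  set c₀ : ℝ := Real.sqrt (M₀ / (κ + 1)) with hc₀
  have hκ1 : 0 < κ + 1 := by linarith
  have hc₀pos : 0 < c₀ := Real.sqrt_pos.2 (div_pos hM₀ hκ1)
  have hc₀sq : c₀ ^ 2 = M₀ / (κ + 1) := Real.sq_sqrt (div_pos hM₀ hκ1).le
  have hκc₀ : κ * c₀ ^ 2 ≤ M₀ := by
    rw [hc₀sq, mul_div_assoc']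
    rw [div_le_iff₀ hκ1]
    nlinarith
  refine ⟨c₀, hc₀pos, ?_⟩
  intro ν hν u₀ hu hd hdiv hbdd
  refine stub_clayOfBackwardBounded ν hν u₀ hu hd hdiv ?_
  intro T hT u p hsol hLH hu0 x₀
  -- the classical Leray–Hopf solution is a Kato solution on `[0, T)`
  have hLH' : IsLerayHopfOn T ν 0 (u 0) u := by rw [hu0]; exact hLH
  have hd0 : HasRapidSpatialDecay (u 0) := by rw [hu0]; exact hd
  have hK : IsKatoSolutionOn T ν u₀ u := by
    have h := isKatoSolutionOn_of_classical hν hT hsol hLH' hd0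
    rwa [hu0] at h
  -- the (small) envelope constant and the Morrey constant
  set C : ℝ := c₀ * ν with hC
  have hC0 : 0 ≤ C := by positivity
  -- Tao-class states with Fourier side on `[0, Tt]`, `Tt < T`, identified with `u`
  have hstate : ∀ Tt : ℝ, 0 < Tt → Tt < T →
      ∃ (u' : ℝ → EuclideanSpace ℝ (Fin 3) → EuclideanSpace ℝ (Fin 3))
        (p' : ℝ → EuclideanSpace ℝ (Fin 3) → ℝ) (V : ℝ → EuclideanSpace ℝ (Fin 3) → Fin 3 → ℂ),
        IsTaoSolutionOn Tt ν u₀ u' p' ∧ IsFourierMild (4 * Real.pi ^ 2 * ν) 4 0 Tt V ∧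
        (∀ t ∈ Icc 0 Tt, u' t = synthVel (V t)) ∧ V 0 = fourierData hu hd ∧
        ∀ t ∈ Icc 0 Tt, u' t = u t := by
    intro Tt hTt0 hTtT
    obtain ⟨u', p', V, hTao, hV, hsyn, hV0⟩ :=
      stub_stateOfKato ν hν u₀ hu hd hdiv T u hK Tt hTt0 hTtT
    refine ⟨u', p', V, hTao, hV, hsyn, hV0, fun t htI => ?_⟩
    have hae : u' t =ᵐ[volume] u t :=
      hTao.ae_eq_of_kato_Icc hν hTt0 (hK.mild.mono (Ico_subset_Ico_right hTtT.le))
        (hK.continuousInLpOn.mono fun s hs => ⟨hs.1, lt_of_le_of_lt hs.2 hTtT⟩)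
        (hK.aestronglyMeasurable.mono_measure (Measure.restrict_mono
          (Set.prod_mono (Ioo_subset_Ioo_right hTtT.le) Subset.rfl) le_rfl)) t htI
    exact (Continuous.ae_eq_iff_eq volume (hTao.classical.contDiff_velocity htI).continuous
      (hsol.contDiff_velocity ⟨htI.1, lt_of_le_of_lt htI.2 hTtT⟩).continuous).1 hae
  -- boundedness of `u` on closed sub-slabs
  have hbd : ∀ t < T, ∃ B : ℝ, ∀ s ∈ Icc 0 t, ∀ x, ‖u s x‖ ≤ B := by
    intro t htT
    set Tt : ℝ := (max t 0 + T) / 2 with hTt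
    have hTt0 : 0 < Tt := by
      rw [hTt]; linarith [le_max_right t 0]
    have hTtT : Tt < T := by
      rw [hTt]
      have : max t 0 < T := max_lt htT hT
      linarith
    have htTt : t ≤ Tt := by
      rw [hTt]
      have : max t 0 < T := max_lt htT hT
      linarith [le_max_left t 0]
    obtain ⟨u', p', V, hTao, -, -, -, heq⟩ := hstate Tt hTt0 hTtT
    obtain ⟨B, -, hB⟩ := hTao.exists_bound_velocity
    refine ⟨B, fun s hs x => ?_⟩
    rw [← heq s ⟨hs.1, hs.2.trans htTt⟩]
    exact hB s ⟨hs.1, hs.2.trans htTt⟩ x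
  -- the Morrey bound on every slice `0 < t < T`
  have hMorrey : ∀ t ∈ Ioo 0 T, ∀ (x₁ : EuclideanSpace ℝ (Fin 3)) (r : ℝ), 0 < r → 17 * r ≤ 1 →
      ∫ x in ball x₁ r, ‖u t x‖ ^ 2 ≤ κ * C ^ 2 * r := by
    intro t ht x₁ r hr _
    set Tt : ℝ := (t + T) / 2 with hTt
    have hTt0 : 0 < Tt := by rw [hTt]; linarith [ht.1, ht.2]
    have htTt : t < Tt := by rw [hTt]; linarith [ht.2]
    have hTtT : Tt < T := by rw [hTt]; linarith [ht.2]
    obtain ⟨u', p', V, hTao, hV, hsyn, hV0, heq⟩ := hstate Tt hTt0 hTtT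
    have htI : t ∈ Icc 0 Tt := ⟨ht.1.le, htTt.le⟩
    have henv : ∀ ξ : EuclideanSpace ℝ (Fin 3), ‖ξ‖ ^ 2 * ‖V t ξ‖ ≤ C :=
      fun ξ => hbdd Tt V hV hV0 t htI ξ
    have hdecV : ∀ K : ℕ, ∃ B, HasDecay K B (V t) := fun K => by
      obtain ⟨B, hB⟩ := hV.decay K
      exact ⟨B, hB t⟩
    have hm := hMor C (V t) hC0 (hV.continuous_slice t) hdecV (fun ξ l => hV.conjSymm t ξ l) henv
      x₁ r hr
    rw [← heq t htI, hsyn t htI]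
    exact hm
  -- suppose `(T, x₀)` were not backward bounded: record points, zooms, the ancient limit
  by_contra hnot
  have hcont : ContinuousOn (uncurry u) (Ico 0 T ×ˢ univ) := hsol.smooth_velocity.continuousOn
  obtain ⟨tc, xc, Λ, e, htc, he, hte, hΛ, hΛeq, hdom, hΛlim, hprod⟩ :=
    stub_recordSequence T hT u hcont hbd x₀ hnot
  obtain ⟨z, hz⟩ : ∃ z : ℕ → ℝ → EuclideanSpace ℝ (Fin 3) → EuclideanSpace ℝ (Fin 3),
      ∀ n s y, z n s y = (Λ n)⁻¹ • u (tc n + ν / Λ n ^ 2 * s) (xc n + (ν / Λ n) • y) :=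
    ⟨fun n s y => (Λ n)⁻¹ • u (tc n + ν / Λ n ^ 2 * s) (xc n + (ν / Λ n) • y), fun _ _ _ => rfl⟩
  obtain ⟨s₀, hs₀, hpers⟩ := stub_nearFinalPersistence ν T hν hT u p hsol hLH' tc xc Λ e htc he hte
    hΛ hΛeq hdom hprod z hz
  obtain ⟨φ, v, hφ, hpt, hmild, hsm, hoseen, hMv⟩ := zoomLimitMorrey_explicit ν T hν hT u p hsol hLH'
    (κ * C ^ 2) hMorrey tc xc Λ e htc he hte hΛ hdom hΛlim hprod z hz
  -- the limit is nonzero at `(s₀, 0)` …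
  have hlow : (1 / 2 : ℝ) ≤ ‖v s₀ 0‖ :=
    ge_of_tendsto ((hpt s₀ hs₀ 0).norm) ((hφ.tendsto_atTop).eventually hpers)
  -- … has Morrey constant `κ C²/ν² = κ c₀² ≤ M₀` …
  have hcst : κ * C ^ 2 / ν ^ 2 = κ * c₀ ^ 2 := by
    rw [hC]
    field_simp
  have hMv' : ∀ t < 0, ∀ (y : EuclideanSpace ℝ (Fin 3)) (r : ℝ), 0 < r →
      ∫ x in ball y r, ‖v t x‖ ^ 2 ≤ M₀ * r := by
    intro t ht y r hr
    calc ∫ x in ball y r, ‖v t x‖ ^ 2 ≤ κ * C ^ 2 / ν ^ 2 * r := hMv t ht y r hr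
      _ = κ * c₀ ^ 2 * r := by rw [hcst]
      _ ≤ M₀ * r := mul_le_mul_of_nonneg_right hκc₀ hr.le
  -- … and is therefore zero by the small-Morrey Liouville theorem
  have hzero : v s₀ 0 = 0 := hLiou v hmild hsm hoseen hMv' s₀ hs₀ 0
  rw [hzero, norm_zero] at hlow
  norm_num at hlow

end Summit.NavierStokesRegularity.NavierStokesRegularity.Theorems.BoundedEnvelope

end
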